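import Mathlib
import Summits.Ventures.PercRepro2.CoinKSureAD
import Summits.Ventures.PercRepro2.CoinChainScStates

/-!
# The modified state law of a gate: log-supermodularity, FKG and level sums
(blind cell PercRepro2, night-2 g24; proofs/NIGHT2-DARC.md §64)

Three self-contained steps of the gate-only inequality (SC) of `CoinChainScAbstract`:
`modified_state_lsm` (a state law that is log-supermodular on the state lattice stays so when its
ideal mass is scaled down by `κ = g/r`, provided the disjoint pairs satisfy the modified
Ahlswede–Daykin inequality `r N(e) N(e') ≤ g N(∅) N(e ∪ e')`), `modified_state_fkg` (FKG on the
state lattice for a log-supermodular state law and two state functions increasing on its support)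
and `level_sum_eq` (a level sum over the entered states of `N(e)(ΛX̄_e − Λ₁)` is the cluster sum
`Λ ∑_P G' x − Λ₁ ∑_P G'` over the corresponding cluster-level set `P`).
-/

namespace Summit.Ventures.PercRepro2.Coin

open Classical

section ScLevels

variable {V : Type*} [DecidableEq V] {R : Type*} [Field R] [LinearOrder R] [IsStrictOrderedRing R]

/-- **The modified state law is log-supermodular.** `N` log-supermodular on `ent.powerset`,
`hmod` the modified inequality for disjoint nonempty states, `r > 0`, `κ r = g`; then
`N' e = (if e = ∅ then κ N e else N e)` is log-supermodular. -/
theorem modified_state_lsm (ent : Finset V) (N : Finset V → R) (r g κ : R) (hrpos : 0 < r)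
    (hκr : κ * r = g)
    (hlsm : ∀ e ⊆ ent, ∀ e' ⊆ ent, N e * N e' ≤ N (e ∩ e') * N (e ∪ e'))
    (hmod : ∀ e ⊆ ent, ∀ e' ⊆ ent, e ∩ e' = ∅ → e ≠ ∅ → e' ≠ ∅ →
      r * (N e * N e') ≤ g * (N ∅ * N (e ∪ e'))) :
    ∀ e ⊆ ent, ∀ e' ⊆ ent, (if e = ∅ then κ * N e else N e) * (if e' = ∅ then κ * N e' else N e') ≤
      (if e ∩ e' = ∅ then κ * N (e ∩ e') else N (e ∩ e')) *
        (if e ∪ e' = ∅ then κ * N (e ∪ e') else N (e ∪ e')) := by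
  intro e he e' he'
  by_cases h1 : e = ∅
  · subst h1
    rw [Finset.empty_inter, Finset.empty_union]
  by_cases h2 : e' = ∅
  · subst h2
    rw [Finset.inter_empty, Finset.union_empty, mul_comm]
  have hu : ¬ (e ∪ e' = ∅) := by
    intro h; apply h1; exact (Finset.union_eq_empty.mp h).1
  rw [if_neg h1, if_neg h2, if_neg hu]
  by_cases h3 : e ∩ e' = ∅
  · rw [if_pos h3, h3]
    have key := hmod e he e' he' h3 h1 h2
    have key' : r * (N e * N e') ≤ r * (κ * N ∅ * N (e ∪ e')) := by
      calc r * (N e * N e') ≤ g * (N ∅ * N (e ∪ e')) := key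
        _ = r * (κ * N ∅ * N (e ∪ e')) := by rw [← hκr]; ring
    exact le_of_mul_le_mul_left key' hrpos
  · rw [if_neg h3]
    exact hlsm e he e' he'

/-- **FKG on the state lattice**: for a nonnegative log-supermodular state law `N'` and two
nonnegative state functions increasing on its support,
`(∑ N' X)(∑ N' Y) ≤ (∑ N')(∑ N' X Y)`. -/
theorem modified_state_fkg (ent : Finset V) (N' X Y : Finset V → R)
    (hN'0 : ∀ e, 0 ≤ N' e) (hX0 : ∀ e, 0 ≤ X e) (hY0 : ∀ e, 0 ≤ Y e)
    (hlsm : ∀ e ⊆ ent, ∀ e' ⊆ ent, N' e * N' e' ≤ N' (e ∩ e') * N' (e ∪ e'))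
    (hXm : ∀ e e', e ⊆ e' → N' e ≠ 0 → N' e' ≠ 0 → X e ≤ X e')
    (hYm : ∀ e e', e ⊆ e' → N' e ≠ 0 → N' e' ≠ 0 → Y e ≤ Y e') :
    (∑ e ∈ ent.powerset, N' e * X e) * (∑ e ∈ ent.powerset, N' e * Y e) ≤
      (∑ e ∈ ent.powerset, N' e) * (∑ e ∈ ent.powerset, N' e * (X e * Y e)) := by
  have n₁ : ∀ e, 0 ≤ N' e * X e := fun e => mul_nonneg (hN'0 e) (hX0 e)
  have n₂ : ∀ e, 0 ≤ N' e * Y e := fun e => mul_nonneg (hN'0 e) (hY0 e)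
  have n₄ : ∀ e, 0 ≤ N' e * (X e * Y e) :=
    fun e => mul_nonneg (hN'0 e) (mul_nonneg (hX0 e) (hY0 e))
  refine ad_pointwise ent _ _ _ _ n₁ n₂ hN'0 n₄ ?_
  intro e he e' he'
  by_cases hs0 : N' e = 0
  · rw [hs0, zero_mul, zero_mul]; exact mul_nonneg (hN'0 _) (n₄ _)
  · by_cases ht0 : N' e' = 0
    · rw [ht0, zero_mul, mul_zero]; exact mul_nonneg (hN'0 _) (n₄ _)
    · have hl := hlsm e he e' he'
      have hpos : 0 < N' e * N' e' :=
        mul_pos (lt_of_le_of_ne (hN'0 e) (Ne.symm hs0)) (lt_of_le_of_ne (hN'0 e') (Ne.symm ht0))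
      have hu0 : N' (e ∪ e') ≠ 0 := by
        intro hz; rw [hz, mul_zero] at hl; exact absurd (lt_of_lt_of_le hpos hl) (lt_irrefl 0)
      have hxs : X e ≤ X (e ∪ e') := hXm e (e ∪ e') Finset.subset_union_left hs0 hu0
      have hyt : Y e' ≤ Y (e ∪ e') := hYm e' (e ∪ e') Finset.subset_union_right ht0 hu0
      calc N' e * X e * (N' e' * Y e') = (N' e * N' e') * (X e * Y e') := by ring
        _ ≤ (N' (e ∩ e') * N' (e ∪ e')) * (X (e ∪ e') * Y (e ∪ e')) :=
            mul_le_mul hl (mul_le_mul hxs hyt (hY0 e') (hX0 _))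
              (mul_nonneg (hX0 e) (hY0 e')) (mul_nonneg (hN'0 _) (hN'0 _))
        _ = N' (e ∩ e') * (N' (e ∪ e') * (X (e ∪ e') * Y (e ∪ e'))) := by ring

/-- **A level sum over the entered states is a cluster sum.** For a state function `w` with
`w ∅ < t` and a state law `N'` equal to the gate mass `N` off `∅`,
`∑_{t ≤ w e} N'(e)(Λ X̄_e − Λ₁) = Λ ∑_{t ≤ w(W ∩ ent)} G' x − Λ₁ ∑_{t ≤ w(W ∩ ent)} G'`
(`X̄_e` the gate mean of `x` on the state `e`). -/
theorem level_sum_eq (U ent : Finset V) (G' x : Finset V → R) (hG' : ∀ W, 0 ≤ G' W)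
    (N' w : Finset V → R) (t Λ Λ₁ : R) (ht : w ∅ < t)
    (hN' : ∀ e, e ≠ ∅ → N' e = ∑ W ∈ U.powerset.filter (fun W => W ∩ ent = e), G' W) :
    (∑ e ∈ ent.powerset.filter (fun e => t ≤ w e), N' e *
        (Λ * ((∑ W ∈ U.powerset.filter (fun W => W ∩ ent = e), G' W * x W) /
          (∑ W ∈ U.powerset.filter (fun W => W ∩ ent = e), G' W)) - Λ₁)) =
      Λ * (∑ W ∈ U.powerset.filter (fun W => t ≤ w (W ∩ ent)), G' W * x W) -
        Λ₁ * (∑ W ∈ U.powerset.filter (fun W => t ≤ w (W ∩ ent)), G' W) := by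
  set N : Finset V → R := fun e => ∑ W ∈ U.powerset.filter (fun W => W ∩ ent = e), G' W with hN
  set Nx : Finset V → R :=
    fun e => ∑ W ∈ U.powerset.filter (fun W => W ∩ ent = e), G' W * x W with hNx
  have hNXs : ∀ e, N e * (Nx e / N e) = Nx e := by
    intro e
    by_cases h : N e = 0
    · have hx := fiber_zero U ent e G' x hG' h
      rw [h, zero_mul]; exact hx.symm
    · field_simp
  have hne : ∀ e ∈ ent.powerset.filter (fun e => t ≤ w e), ¬ (e = ∅) := by
    intro e he hz
    have := (Finset.mem_filter.mp he).2
    rw [hz] at this; linarith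
  have e1 : (∑ e ∈ ent.powerset.filter (fun e => t ≤ w e), N' e * (Λ * (Nx e / N e) - Λ₁)) =
      ∑ e ∈ ent.powerset.filter (fun e => t ≤ w e), (Λ * Nx e - Λ₁ * N e) := by
    refine Finset.sum_congr rfl fun e he => ?_
    rw [hN' e (hne e he)]
    have := hNXs e
    calc N e * (Λ * (Nx e / N e) - Λ₁) = Λ * (N e * (Nx e / N e)) - Λ₁ * N e := by ring
      _ = Λ * Nx e - Λ₁ * N e := by rw [this]
  show (∑ e ∈ ent.powerset.filter (fun e => t ≤ w e), N' e * (Λ * (Nx e / N e) - Λ₁)) = _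
  rw [e1, Finset.sum_sub_distrib, ← Finset.mul_sum, ← Finset.mul_sum]
  have e2 := sum_states_filter_eq U ent G' (fun _ => (1 : R)) (fun e => t ≤ w e)
  simp only [mul_one] at e2
  have e4 : (∑ e ∈ ent.powerset.filter (fun e => t ≤ w e), Nx e) =
      ∑ W ∈ U.powerset.filter (fun W => t ≤ w (W ∩ ent)), G' W * x W := by
    have hmaps : ∀ W ∈ U.powerset, (fun W => W ∩ ent) W ∈ ent.powerset :=
      fun W _ => Finset.mem_powerset.mpr Finset.inter_subset_right
    rw [Finset.sum_filter, Finset.sum_filter, ← Finset.sum_fiberwise_of_maps_to hmaps]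
    refine Finset.sum_congr rfl fun e _ => ?_
    by_cases hQ : t ≤ w e
    · rw [if_pos hQ]
      refine Finset.sum_congr rfl fun W hW => ?_
      have h := (Finset.mem_filter.mp hW).2
      rw [h, if_pos hQ]
    · rw [if_neg hQ]
      symm
      refine Finset.sum_eq_zero fun W hW => ?_
      have h := (Finset.mem_filter.mp hW).2
      rw [h, if_neg hQ]
  rw [e4, e2]

omit [DecidableEq V] [LinearOrder R] [IsStrictOrderedRing R] in
/-- The expansion of a centred sum over any index set. -/
lemma centred_expand_sc (G x y : Finset V → R) (S : Finset (Finset V)) (Λ Λ₁ Λ₂ : R) :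
    ∑ W ∈ S, G W * ((Λ * x W - Λ₁) * (Λ * y W - Λ₂)) =
      Λ * Λ * (∑ W ∈ S, G W * (x W * y W)) - Λ * Λ₂ * (∑ W ∈ S, G W * x W)
        - Λ * Λ₁ * (∑ W ∈ S, G W * y W) + Λ₁ * Λ₂ * (∑ W ∈ S, G W) := by
  rw [Finset.mul_sum, Finset.mul_sum, Finset.mul_sum, Finset.mul_sum, ← Finset.sum_sub_distrib,
    ← Finset.sum_sub_distrib, ← Finset.sum_add_distrib]
  exact Finset.sum_congr rfl (fun W _ => by ring)

end ScLevels

end Summit.Ventures.PercRepro2.Coin
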